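import Mathlib
import Literature.NumberTheory.Automorphic.GaloisActionPlaces
import HarnessLib

/-!
# Two glue rows for the twist-norm law `(n) = 𝔞 · c𝔞` of a CM field: `n ∣ N²` for `N ∈ 𝔞`, and `#κ(𝔭_w) = #(𝓞 F ⧸ 𝔭_{c•w})`

Topic `Literature/NumberTheory/NumberFields`, namespace `Literature.NumberTheory.NumberFields`.  THEOREMS ONLY (no `def`, no instance, no named fact),
Mathlib + ★ `Automorphic/GaloisActionPlaces` (`HeightOneSpectrum.card_quotient_smul`).

## Source (read at the page) and what is recorded

G. Shimura, *Abelian Varieties with Complex Multiplication and Modular Functions* (1998), §13.1 Theorem 1 (pp. 97–99) (the norm equation `𝔞 𝔞^ρ = (q)` of the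
Frobenius twist ideal); J. S. Milne, *Algebraic Number Theory* (v3.00), Thm. 3.7 (p. 42).  Two ELEMENTARY glue rows asked by the cell `hodgecm-mathlib` L3 cover assembly
(LA3-plan DEAL v4 (iii)(iv), the `(cov)` conjunct of `stub_TWISTCOVER0`):
* `dvd_sq_of_span_eq_mul_complexConj_smul_of_natCast_mem` — `(n) = 𝔞 · c𝔞` and `N ∈ 𝔞` (`N ∈ ℕ`) ⇒ `n ∣ N²` (`c` fixes `N`, so `N² ∈ 𝔞·c𝔞 = (n)`, then take
  `Algebra.norm ℤ` and extract `[F:ℚ]`-th roots in `ℤ`);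
* `natCard_residueField_eq_of_natCard_quotient_complexConj_smul` — `Nat.card (𝓞 F ⧸ 𝔭_{c•w}) = q ⇒ Nat.card (𝔭_w.ResidueField) = q` (conjugate primes have residue
  rings of the same size, ★ `card_quotient_smul`; the residue field of a maximal ideal is its quotient, Mathlib `Ideal.bijective_algebraMap_quotient_residueField`).
  (Same statement as the Summits-side ★ `Theorems/F0P6aCanonicalFrobeniusIdealCounts.card_residueField_eq_of_card_quotient_smul`, which a Literature-lane consumer
  cannot import.)
`--supports stmt-HodgeConjecture-24832`, count-neutral.

## Mathlib / tree search

Mathlib: `Algebra.norm_algebraMap`, `NumberField.RingOfIntegers.rank`, `Int.pow_dvd_pow_iff`, `Int.natCast_dvd_natCast`, `Ideal.mem_span_singleton`, `Ideal.mul_mem_mul`,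
`Ideal.smul_mem_pointwise_smul`, `Ideal.bijective_algebraMap_quotient_residueField`; tree ★ `GaloisActionPlaces` (`card_quotient_smul`), ★ `IdealNormEquationSupportPin`
(same `(n) = 𝔞 · c𝔞` token shape; not imported).
-/

namespace Literature.NumberTheory.NumberFields

open NumberField IsDedekindDomain
open scoped Pointwise

variable {F : Type*} [Field F] [NumberField F]

/-- A natural number divides another as soon as it does in `𝓞 F` (take `Algebra.norm ℤ`: `n^{[F:ℚ]} ∣ m^{[F:ℚ]}` in `ℤ`, then extract roots).
[cite: MilneANT2008, Thm. 3.7 (p. 42)] -/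
theorem natCast_dvd_natCast_ringOfIntegers_iff {n m : ℕ} : ((n : ℕ) : 𝓞 F) ∣ ((m : ℕ) : 𝓞 F) ↔ n ∣ m := by
  refine ⟨fun h => ?_, fun h => Nat.cast_dvd_cast h⟩
  have hd : Module.finrank ℤ (𝓞 F) ≠ 0 := by
    rw [RingOfIntegers.rank]
    exact Module.finrank_pos.ne'
  have h' := map_dvd (Algebra.norm ℤ) h
  rw [← map_natCast (algebraMap ℤ (𝓞 F)) n, ← map_natCast (algebraMap ℤ (𝓞 F)) m, Algebra.norm_algebraMap, Algebra.norm_algebraMap,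
    Int.pow_dvd_pow_iff hd, Int.natCast_dvd_natCast] at h'
  exact h'

/-- **`(n) = 𝔞 · c𝔞` and `N ∈ 𝔞` imply `n ∣ N²`** (`c • N = N ∈ c•𝔞`, so `N² ∈ 𝔞 · c𝔞 = (n)`) — the arithmetic glue between the twist-norm law and a Serre
presentation of `𝔞` by `N`-division (L3 cover assembly, `hk : n * k = N²`). [cite: Shimura1998, §13.1 Thm. 1 (pp. 97–99)] -/
theorem dvd_sq_of_span_eq_mul_complexConj_smul_of_natCast_mem [IsCMField F] {𝔞 : Ideal (𝓞 F)} {n N : ℕ}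
    (h : Ideal.span {((n : ℕ) : 𝓞 F)} = 𝔞 * (IsCMField.complexConj F) • 𝔞) (hN : ((N : ℕ) : 𝓞 F) ∈ 𝔞) : n ∣ N ^ 2 := by
  have hcN : ((N : ℕ) : 𝓞 F) ∈ (IsCMField.complexConj F) • 𝔞 := by
    have hfix : (IsCMField.complexConj F) • ((N : ℕ) : 𝓞 F) = ((N : ℕ) : 𝓞 F) := by
      rw [← MulSemiringAction.toRingHom_apply, map_natCast]
    simpa only [hfix] using Ideal.smul_mem_pointwise_smul (IsCMField.complexConj F) _ 𝔞 hN
  have hNN : ((N : ℕ) : 𝓞 F) * ((N : ℕ) : 𝓞 F) ∈ Ideal.span {((n : ℕ) : 𝓞 F)} := by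
    rw [h]
    exact Ideal.mul_mem_mul hN hcN
  rw [← natCast_dvd_natCast_ringOfIntegers_iff (F := F), Nat.cast_pow, sq]
  exact Ideal.mem_span_singleton.1 hNN

/-- **`Nat.card (𝓞 F ⧸ 𝔭_{c•w}) = q ⇒ Nat.card (𝔭_w.ResidueField) = q`** (the spine states the residue cardinality at `c•w`, the cover head reads it at `w` through
`Ideal.ResidueField`). [cite: Shimura1998, §13.1 Thm. 1 (pp. 97–99)] -/
theorem natCard_residueField_eq_of_natCard_quotient_complexConj_smul [IsCMField F] (w : HeightOneSpectrum (𝓞 F)) {q : ℕ}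
    (h : Nat.card (𝓞 F ⧸ ((IsCMField.complexConj F) • w).asIdeal) = q) : Nat.card w.asIdeal.ResidueField = q := by
  haveI := w.isMaximal
  rw [← h, Literature.NumberTheory.Automorphic.HeightOneSpectrum.card_quotient_smul,
    ← Nat.card_eq_of_bijective _ w.asIdeal.bijective_algebraMap_quotient_residueField]

end Literature.NumberTheory.NumberFields
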